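import Mathlib
import Literature.Analysis.FluidPDE.GaussianVortexPlanar
import Literature.Analysis.FluidPDE.GaussianVortexPlanarProofs
import Literature.Analysis.FluidPDE.BiotSavart2DSymmetry
import Summits.AnomalousDissipation.AnomalousDissipation.Theorems.MarginalStabilityChainStretchedVortexRowsStubLogPotentialTools
import Summits.AnomalousDissipation.AnomalousDissipation.Theorems.MarginalStabilityChainStretchedVortexRowsStubLogPotentialGradient
import Summits.AnomalousDissipation.AnomalousDissipation.Theorems.MarginalStabilityChainStretchedVortexRowsStubLogPotentialGreen
import HarnessLib

/-!
# Helper `logPotential_gradient_decay` toward stub `stub_coreInverse` of the line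
# `braid-closed-large-circulation-gluing` (crux stmt-AnomalousDissipation-3009, `MarginalStabilityChain.StretchedVortexRows`)

Far-field decay of the gradient of the logarithmic potential `ψ = N ∗ g` of a NEUTRAL Gaussian-class density on
`ℝ² = EuclideanSpace ℝ (Fin 2)` (wave 3, toward `logPotential_neutral_energy`): `‖∇ψ(ξ)‖ ≤ C/(1 + ‖ξ‖)²`, whence
`‖∇ψ‖² ∈ L¹(ℝ²)`.

* the kernel `DN(z) = (2π‖z‖²)⁻¹ z` is differentiable off the origin with `‖D(DN)(z)‖ ≤ 3 (2π‖z‖²)⁻¹`, so by the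
  mean value inequality on the ball `B(ξ, ‖ξ‖/2)`: `‖DN(ξ − η) − DN(ξ)‖ ≤ 12 (2π‖ξ‖²)⁻¹ ‖η‖` for `‖η‖ < ‖ξ‖/2`;
* NEUTRALITY `∫ g = 0` gives `∇ψ(ξ) = ∫ g(η) (DN(ξ − η) − DN(ξ)) dη`; the near region contributes `O(‖ξ‖⁻²)`, the
  far region `‖η‖ ≥ ‖ξ‖/2` is Gaussian-small (`e^{−‖η‖²/8} ≤ e^{−‖ξ‖²/64} e^{−‖η‖²/16}`, `e^{−‖ξ‖²/64} ≤ 64/‖ξ‖²`);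
* the near field `‖ξ‖ < 1` is covered by the uniform bound `∫ ‖g(η) DN(ξ − η)‖ dη ≤ M`.
-/

set_option linter.dupNamespace false
noncomputable section
open scoped RealInnerProductSpace Topology
open MeasureTheory WithLp Function Metric Filter Set

namespace Summit.AnomalousDissipation.AnomalousDissipation.Theorems.MarginalStabilityChainStretchedVortexRows

open Literature.Analysis.FluidPDE

/-! ### Calculus of the kernel `DN(z) = (2π‖z‖²)⁻¹ z` away from the origin -/

/-- `DN` is differentiable off the origin with `‖D(DN)(z)‖ ≤ 3 (2π‖z‖²)⁻¹`
(`D(z/‖z‖²)[v] = v/‖z‖² − 2⟪z, v⟫ z/‖z‖⁴`). [folklore] -/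
theorem exists_hasFDerivAt_gradLogKernel {z : EuclideanSpace ℝ (Fin 2)} (hz : z ≠ 0) :
    ∃ L : EuclideanSpace ℝ (Fin 2) →L[ℝ] EuclideanSpace ℝ (Fin 2),
      HasFDerivAt (fun w : EuclideanSpace ℝ (Fin 2) => (2 * Real.pi * ‖w‖ ^ 2)⁻¹ • w) L z ∧
        ‖L‖ ≤ 3 * (2 * Real.pi * ‖z‖ ^ 2)⁻¹ := by
  have hn : 0 < ‖z‖ := norm_pos_iff.2 hz
  have hs : HasFDerivAt (fun w : EuclideanSpace ℝ (Fin 2) => 2 * Real.pi * ‖w‖ ^ 2)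
      ((2 * Real.pi) • ((2:ℝ) • innerSL ℝ z)) z := by
    refine ((hasStrictFDerivAt_norm_sq z).hasFDerivAt.const_mul (2 * Real.pi)).congr_fderiv ?_
    ext v
    simp [two_smul, two_mul]
  have hs0 : 0 < 2 * Real.pi * ‖z‖ ^ 2 := by positivity
  have hc := (hasDerivAt_inv hs0.ne').comp_hasFDerivAt z hs
  refine ⟨_, hc.smul (hasFDerivAt_id z), ?_⟩
  refine ContinuousLinearMap.opNorm_le_bound _ (by positivity) fun v => ?_
  have happ : ((2 * Real.pi * ‖z‖ ^ 2)⁻¹ • ContinuousLinearMap.id ℝ (EuclideanSpace ℝ (Fin 2)) +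
      ((-((2 * Real.pi * ‖z‖ ^ 2) ^ 2)⁻¹) • ((2 * Real.pi) • ((2:ℝ) • innerSL ℝ z))).smulRight
        ((id : EuclideanSpace ℝ (Fin 2) → EuclideanSpace ℝ (Fin 2)) z)) v =
      (2 * Real.pi * ‖z‖ ^ 2)⁻¹ • v + (-((2 * Real.pi * ‖z‖ ^ 2) ^ 2)⁻¹ * (2 * Real.pi * (2 * ⟪z, v⟫))) • z := by
    simp only [_root_.add_apply, ContinuousLinearMap.smulRight_apply, FunLike.coe_smul,
      Pi.smul_apply, ContinuousLinearMap.id_apply, innerSL_apply_apply, smul_eq_mul, id]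
  show ‖((2 * Real.pi * ‖z‖ ^ 2)⁻¹ • ContinuousLinearMap.id ℝ (EuclideanSpace ℝ (Fin 2)) +
      ((-((2 * Real.pi * ‖z‖ ^ 2) ^ 2)⁻¹) • ((2 * Real.pi) • ((2:ℝ) • innerSL ℝ z))).smulRight
        ((id : EuclideanSpace ℝ (Fin 2) → EuclideanSpace ℝ (Fin 2)) z)) v‖ ≤
    3 * (2 * Real.pi * ‖z‖ ^ 2)⁻¹ * ‖v‖
  rw [happ]
  have h1 : ‖(2 * Real.pi * ‖z‖ ^ 2)⁻¹ • v‖ = (2 * Real.pi * ‖z‖ ^ 2)⁻¹ * ‖v‖ := by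
    rw [norm_smul, Real.norm_of_nonneg (inv_nonneg.2 hs0.le)]
  have h2 : ‖(-((2 * Real.pi * ‖z‖ ^ 2) ^ 2)⁻¹ * (2 * Real.pi * (2 * ⟪z, v⟫))) • z‖ ≤
      2 * (2 * Real.pi * ‖z‖ ^ 2)⁻¹ * ‖v‖ := by
    rw [norm_smul, Real.norm_eq_abs, abs_mul, abs_neg, abs_inv, abs_of_pos (by positivity : (0:ℝ) < _ ^ 2)]
    have hi := abs_real_inner_le_norm z v
    rw [abs_mul, abs_of_pos (by positivity : (0:ℝ) < 2 * Real.pi), abs_mul, abs_two]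
    calc ((2 * Real.pi * ‖z‖ ^ 2) ^ 2)⁻¹ * (2 * Real.pi * (2 * |⟪z, v⟫|)) * ‖z‖
        ≤ ((2 * Real.pi * ‖z‖ ^ 2) ^ 2)⁻¹ * (2 * Real.pi * (2 * (‖z‖ * ‖v‖))) * ‖z‖ := by gcongr
      _ = 2 * (2 * Real.pi * ‖z‖ ^ 2)⁻¹ * ‖v‖ := by field_simp
  calc _ ≤ ‖(2 * Real.pi * ‖z‖ ^ 2)⁻¹ • v‖ +
        ‖(-((2 * Real.pi * ‖z‖ ^ 2) ^ 2)⁻¹ * (2 * Real.pi * (2 * ⟪z, v⟫))) • z‖ := norm_add_le _ _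
    _ ≤ (2 * Real.pi * ‖z‖ ^ 2)⁻¹ * ‖v‖ + 2 * (2 * Real.pi * ‖z‖ ^ 2)⁻¹ * ‖v‖ := by rw [h1]; gcongr
    _ = 3 * (2 * Real.pi * ‖z‖ ^ 2)⁻¹ * ‖v‖ := by ring

/-- **Mean-value bound for the kernel**: `‖DN(ξ − η) − DN(ξ)‖ ≤ 12 (2π‖ξ‖²)⁻¹ ‖η‖` for `‖η‖ < ‖ξ‖/2`
(the segment stays in `‖·‖ > ‖ξ‖/2`, where `‖D(DN)‖ ≤ 3 (2π(‖ξ‖/2)²)⁻¹`). [folklore] -/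
theorem norm_gradLogKernel_sub_le {ξ η : EuclideanSpace ℝ (Fin 2)} (hξ : ξ ≠ 0) (hη : ‖η‖ < ‖ξ‖ / 2) :
    ‖(2 * Real.pi * ‖ξ - η‖ ^ 2)⁻¹ • (ξ - η) - (2 * Real.pi * ‖ξ‖ ^ 2)⁻¹ • ξ‖ ≤
      12 * (2 * Real.pi * ‖ξ‖ ^ 2)⁻¹ * ‖η‖ := by
  have hn : 0 < ‖ξ‖ := norm_pos_iff.2 hξ
  have hmem : ∀ x ∈ ball ξ (‖ξ‖ / 2), ‖ξ‖ / 2 < ‖x‖ := fun x hx => by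
    rw [mem_ball_iff_norm] at hx
    have := norm_le_norm_add_norm_sub' ξ x
    rw [norm_sub_rev] at this
    linarith
  have hdiff : ∀ x ∈ ball ξ (‖ξ‖ / 2),
      DifferentiableAt ℝ (fun w : EuclideanSpace ℝ (Fin 2) => (2 * Real.pi * ‖w‖ ^ 2)⁻¹ • w) x := fun x hx => by
    have hx0 : x ≠ 0 := norm_pos_iff.1 (by linarith [hmem x hx])
    obtain ⟨L, hL, -⟩ := exists_hasFDerivAt_gradLogKernel hx0
    exact hL.differentiableAt
  have hbound : ∀ x ∈ ball ξ (‖ξ‖ / 2),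
      ‖fderiv ℝ (fun w : EuclideanSpace ℝ (Fin 2) => (2 * Real.pi * ‖w‖ ^ 2)⁻¹ • w) x‖ ≤
        3 * (2 * Real.pi * (‖ξ‖ / 2) ^ 2)⁻¹ := fun x hx => by
    have hx := hmem x hx
    have hx0 : x ≠ 0 := norm_pos_iff.1 (by linarith)
    obtain ⟨L, hL, hLb⟩ := exists_hasFDerivAt_gradLogKernel hx0
    rw [hL.fderiv]
    refine hLb.trans ?_
    gcongr
  have key := (convex_ball ξ (‖ξ‖ / 2)).norm_image_sub_le_of_norm_fderiv_le hdiff hbound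
    (mem_ball_self (by positivity)) (y := ξ - η) (by
      rw [mem_ball_iff_norm, sub_sub_cancel_left, norm_neg]; exact hη)
  rw [sub_sub_cancel_left, norm_neg] at key
  refine key.trans (le_of_eq ?_)
  field_simp
  ring

/-! ### Far-field decay of `∫ g(η) DN(ξ − η) dη` for a NEUTRAL Gaussian-bounded density -/

section Decay

variable {B : ℝ} {g : EuclideanSpace ℝ (Fin 2) → ℝ} (hgc : Continuous g)
  (hg0 : ∀ η, |g η| ≤ B * Real.exp (-(1 / 8) * ‖η‖ ^ 2)) (hneutral : ∫ η, g η = 0)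
include hgc hg0 in
/-- A continuous Gaussian-bounded density is integrable. [folklore] -/
theorem integrable_of_gaussBound : Integrable g := by
  have h0 := integrable_one_add_norm_pow_mul_exp_eighth 0
  simp only [pow_zero, one_mul] at h0
  exact (h0.const_mul B).mono' hgc.aestronglyMeasurable (Eventually.of_forall fun η => by
    rw [Real.norm_eq_abs]; exact hg0 η)

/-- The shell estimate `‖ξ − η‖⁻¹ e^{−‖η‖²/16} ≤ 𝟙_{‖ξ−η‖<1}‖ξ − η‖⁻¹ + e^{−‖η‖²/16}`. [folklore] -/
theorem inv_norm_sub_mul_exp_le (ξ η : EuclideanSpace ℝ (Fin 2)) :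
    ‖ξ - η‖⁻¹ * Real.exp (-(1 / 16) * ‖η‖ ^ 2) ≤
      (ball (0 : EuclideanSpace ℝ (Fin 2)) 1).indicator (fun z => ‖z‖⁻¹) (ξ - η) +
        Real.exp (-(1 / 16) * ‖η‖ ^ 2) := by
  have he : Real.exp (-(1 / 16) * ‖η‖ ^ 2) ≤ 1 := Real.exp_le_one_iff.2 (by nlinarith [norm_nonneg η])
  have he0 : 0 ≤ Real.exp (-(1 / 16) * ‖η‖ ^ 2) := (Real.exp_pos _).le
  have hi0 : 0 ≤ ‖ξ - η‖⁻¹ := inv_nonneg.2 (norm_nonneg _)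
  by_cases hb : ξ - η ∈ ball (0 : EuclideanSpace ℝ (Fin 2)) 1
  · rw [indicator_of_mem hb]; nlinarith
  · rw [indicator_of_notMem hb, zero_add]
    have h3 : ‖ξ - η‖⁻¹ ≤ 1 := inv_le_one_of_one_le₀ (by simpa [mem_ball_zero_iff] using hb)
    nlinarith

include hgc hg0 hneutral in
/-- **Far-field decay from neutrality**: for `1 ≤ ‖ξ‖`, `‖∫ g(η) DN(ξ − η) dη‖ ≤ K/‖ξ‖²`. With `∫ g = 0`,
`∫ g(η) DN(ξ−η) dη = ∫ g(η) (DN(ξ−η) − DN(ξ)) dη`; on `‖η‖ < ‖ξ‖/2` the mean-value bound gives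
`O(‖η‖/‖ξ‖²)`, on `‖η‖ ≥ ‖ξ‖/2` the Gaussian tail `e^{−‖η‖²/8} ≤ e^{−‖ξ‖²/64} e^{−‖η‖²/16}` gives `O(e^{−‖ξ‖²/64})`.
[folklore] -/
theorem norm_gradLogConv_le_far :
    ∃ K : ℝ, 0 ≤ K ∧ ∀ ξ : EuclideanSpace ℝ (Fin 2), 1 ≤ ‖ξ‖ →
      ‖∫ η, g η • ((2 * Real.pi * ‖ξ - η‖ ^ 2)⁻¹ • (ξ - η))‖ ≤ K / ‖ξ‖ ^ 2 := by
  have hB : 0 ≤ B := (abs_nonneg _).trans ((hg0 0).trans (le_of_eq (by simp)))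
  have hI₁ := integrable_one_add_norm_pow_mul_exp_eighth 1
  have hI16 := integrable_one_add_norm_pow_mul_exp_sixteenth 0
  obtain ⟨I₁, hI₁def⟩ : ∃ I : ℝ, I = ∫ η : EuclideanSpace ℝ (Fin 2),
      (1 + ‖η‖) ^ 1 * Real.exp (-(1 / 8) * ‖η‖ ^ 2) := ⟨_, rfl⟩
  obtain ⟨Iind, hIind⟩ : ∃ I : ℝ, I = ∫ z, (ball (0 : EuclideanSpace ℝ (Fin 2)) 1).indicator (fun z => ‖z‖⁻¹) z :=
    ⟨_, rfl⟩
  obtain ⟨I16, hI16def⟩ : ∃ I : ℝ, I = ∫ η : EuclideanSpace ℝ (Fin 2),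
      (1 + ‖η‖) ^ 0 * Real.exp (-(1 / 16) * ‖η‖ ^ 2) := ⟨_, rfl⟩
  have hI₁0 : 0 ≤ I₁ := hI₁def ▸ integral_nonneg fun η => by positivity
  have hIind0 : 0 ≤ Iind := hIind ▸ integral_nonneg indicator_inv_norm_nonneg
  have hI160 : 0 ≤ I16 := hI16def ▸ integral_nonneg fun η => by positivity
  obtain ⟨K₁, hK₁⟩ : ∃ K : ℝ, K = B * (12 * (2 * Real.pi)⁻¹) * I₁ := ⟨_, rfl⟩
  obtain ⟨K₂, hK₂⟩ : ∃ K : ℝ, K = B * (2 * Real.pi)⁻¹ * (Iind + 2 * I16) := ⟨_, rfl⟩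
  have hK₁0 : 0 ≤ K₁ := by rw [hK₁]; positivity
  have hK₂0 : 0 ≤ K₂ := by rw [hK₂]; positivity
  refine ⟨K₁ + 64 * K₂, by positivity, fun ξ hξ => ?_⟩
  have hξn : 0 < ‖ξ‖ := by linarith
  have hξ0 : ξ ≠ 0 := norm_pos_iff.1 hξn
  have hint := integrable_smul_gradLogKernel hgc hg0 ξ
  have hgi : Integrable g := integrable_of_gaussBound hgc hg0
  -- neutrality
  have hV : ∫ η, g η • ((2 * Real.pi * ‖ξ - η‖ ^ 2)⁻¹ • (ξ - η)) =
      ∫ η, g η • (((2 * Real.pi * ‖ξ - η‖ ^ 2)⁻¹ • (ξ - η)) - (2 * Real.pi * ‖ξ‖ ^ 2)⁻¹ • ξ) := by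
    have h1 : Integrable fun η => g η • ((2 * Real.pi * ‖ξ‖ ^ 2)⁻¹ • ξ) := hgi.smul_const _
    have h2 : (fun η => g η • (((2 * Real.pi * ‖ξ - η‖ ^ 2)⁻¹ • (ξ - η)) - (2 * Real.pi * ‖ξ‖ ^ 2)⁻¹ • ξ)) =
        fun η => g η • ((2 * Real.pi * ‖ξ - η‖ ^ 2)⁻¹ • (ξ - η)) - g η • ((2 * Real.pi * ‖ξ‖ ^ 2)⁻¹ • ξ) :=
      funext fun η => smul_sub _ _ _
    rw [h2, integral_sub hint h1, integral_smul_const, hneutral, zero_smul, sub_zero]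
  rw [hV]
  -- the pointwise majorant
  obtain ⟨bound, hbdef⟩ : ∃ b : EuclideanSpace ℝ (Fin 2) → ℝ, b = fun η =>
    (‖ξ‖ ^ 2)⁻¹ * (B * (12 * (2 * Real.pi)⁻¹) * ((1 + ‖η‖) ^ 1 * Real.exp (-(1 / 8) * ‖η‖ ^ 2))) +
      Real.exp (-(1 / 64) * ‖ξ‖ ^ 2) * (B * (2 * Real.pi)⁻¹ *
        ((ball (0 : EuclideanSpace ℝ (Fin 2)) 1).indicator (fun z => ‖z‖⁻¹) (ξ - η) +
          2 * ((1 + ‖η‖) ^ 0 * Real.exp (-(1 / 16) * ‖η‖ ^ 2)))) := ⟨_, rfl⟩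
  have hb1 : ∀ η : EuclideanSpace ℝ (Fin 2), 0 ≤ (‖ξ‖ ^ 2)⁻¹ * (B * (12 * (2 * Real.pi)⁻¹) *
      ((1 + ‖η‖) ^ 1 * Real.exp (-(1 / 8) * ‖η‖ ^ 2))) := fun η => by positivity
  have hb2 : ∀ η, 0 ≤ Real.exp (-(1 / 64) * ‖ξ‖ ^ 2) * (B * (2 * Real.pi)⁻¹ *
      ((ball (0 : EuclideanSpace ℝ (Fin 2)) 1).indicator (fun z => ‖z‖⁻¹) (ξ - η) +
        2 * ((1 + ‖η‖) ^ 0 * Real.exp (-(1 / 16) * ‖η‖ ^ 2)))) := fun η =>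
    mul_nonneg (Real.exp_pos _).le (mul_nonneg (mul_nonneg hB (by positivity))
      (add_nonneg (indicator_inv_norm_nonneg _) (by positivity)))
  have hbound : ∀ η, ‖g η • (((2 * Real.pi * ‖ξ - η‖ ^ 2)⁻¹ • (ξ - η)) - (2 * Real.pi * ‖ξ‖ ^ 2)⁻¹ • ξ)‖ ≤
      bound η := by
    intro η
    rw [hbdef, norm_smul, Real.norm_eq_abs]
    by_cases hη : ‖η‖ < ‖ξ‖ / 2
    · have hk := norm_gradLogKernel_sub_le hξ0 hη
      calc |g η| * ‖((2 * Real.pi * ‖ξ - η‖ ^ 2)⁻¹ • (ξ - η)) - (2 * Real.pi * ‖ξ‖ ^ 2)⁻¹ • ξ‖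
          ≤ (B * Real.exp (-(1 / 8) * ‖η‖ ^ 2)) * (12 * (2 * Real.pi * ‖ξ‖ ^ 2)⁻¹ * ‖η‖) :=
            mul_le_mul (hg0 η) hk (norm_nonneg _) (by positivity)
        _ ≤ (B * Real.exp (-(1 / 8) * ‖η‖ ^ 2)) * (12 * (2 * Real.pi * ‖ξ‖ ^ 2)⁻¹ * (1 + ‖η‖) ^ 1) := by
            gcongr; rw [pow_one]; linarith [norm_nonneg η]
        _ = (‖ξ‖ ^ 2)⁻¹ * (B * (12 * (2 * Real.pi)⁻¹) * ((1 + ‖η‖) ^ 1 * Real.exp (-(1 / 8) * ‖η‖ ^ 2))) := by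
            field_simp
        _ ≤ _ := le_add_of_nonneg_right (hb2 η)
    · rw [not_lt] at hη
      have hk : ‖((2 * Real.pi * ‖ξ - η‖ ^ 2)⁻¹ • (ξ - η)) - (2 * Real.pi * ‖ξ‖ ^ 2)⁻¹ • ξ‖ ≤
          (2 * Real.pi)⁻¹ * ‖ξ - η‖⁻¹ + (2 * Real.pi)⁻¹ * ‖ξ‖⁻¹ := by
        refine (norm_sub_le _ _).trans (le_of_eq ?_)
        rw [norm_gradLogKernel, norm_gradLogKernel]
      have hgauss : Real.exp (-(1 / 8) * ‖η‖ ^ 2) ≤ Real.exp (-(1 / 64) * ‖ξ‖ ^ 2) * Real.exp (-(1 / 16) * ‖η‖ ^ 2) := by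
        rw [← Real.exp_add]
        exact Real.exp_le_exp.2 (by nlinarith [norm_nonneg ξ, norm_nonneg η])
      have hkey := inv_norm_sub_mul_exp_le ξ η
      have hξinv : ‖ξ‖⁻¹ ≤ 1 := inv_le_one_of_one_le₀ hξ
      have he0 : 0 ≤ Real.exp (-(1 / 16) * ‖η‖ ^ 2) := (Real.exp_pos _).le
      calc |g η| * ‖((2 * Real.pi * ‖ξ - η‖ ^ 2)⁻¹ • (ξ - η)) - (2 * Real.pi * ‖ξ‖ ^ 2)⁻¹ • ξ‖
          ≤ (B * (Real.exp (-(1 / 64) * ‖ξ‖ ^ 2) * Real.exp (-(1 / 16) * ‖η‖ ^ 2))) *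
              ((2 * Real.pi)⁻¹ * ‖ξ - η‖⁻¹ + (2 * Real.pi)⁻¹ * ‖ξ‖⁻¹) :=
            mul_le_mul ((hg0 η).trans (mul_le_mul_of_nonneg_left hgauss hB)) hk (norm_nonneg _) (by positivity)
        _ = Real.exp (-(1 / 64) * ‖ξ‖ ^ 2) * (B * (2 * Real.pi)⁻¹ *
              (‖ξ - η‖⁻¹ * Real.exp (-(1 / 16) * ‖η‖ ^ 2) + ‖ξ‖⁻¹ * Real.exp (-(1 / 16) * ‖η‖ ^ 2))) := by ring
        _ ≤ Real.exp (-(1 / 64) * ‖ξ‖ ^ 2) * (B * (2 * Real.pi)⁻¹ *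
              ((ball (0 : EuclideanSpace ℝ (Fin 2)) 1).indicator (fun z => ‖z‖⁻¹) (ξ - η) +
                Real.exp (-(1 / 16) * ‖η‖ ^ 2) + 1 * Real.exp (-(1 / 16) * ‖η‖ ^ 2))) := by
            gcongr
        _ = Real.exp (-(1 / 64) * ‖ξ‖ ^ 2) * (B * (2 * Real.pi)⁻¹ *
              ((ball (0 : EuclideanSpace ℝ (Fin 2)) 1).indicator (fun z => ‖z‖⁻¹) (ξ - η) +
                2 * ((1 + ‖η‖) ^ 0 * Real.exp (-(1 / 16) * ‖η‖ ^ 2)))) := by ring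
        _ ≤ _ := le_add_of_nonneg_left (hb1 η)
  -- integrate the majorant
  have hi1 : Integrable fun η : EuclideanSpace ℝ (Fin 2) =>
      (ball (0 : EuclideanSpace ℝ (Fin 2)) 1).indicator (fun z => ‖z‖⁻¹) (ξ - η) :=
    integrable_indicator_inv_norm.comp_sub_left ξ
  have hi2 : Integrable fun η : EuclideanSpace ℝ (Fin 2) =>
      2 * ((1 + ‖η‖) ^ 0 * Real.exp (-(1 / 16) * ‖η‖ ^ 2)) := hI16.const_mul 2
  have hi12 : Integrable fun η : EuclideanSpace ℝ (Fin 2) =>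
      (ball (0 : EuclideanSpace ℝ (Fin 2)) 1).indicator (fun z => ‖z‖⁻¹) (ξ - η) +
        2 * ((1 + ‖η‖) ^ 0 * Real.exp (-(1 / 16) * ‖η‖ ^ 2)) := hi1.add hi2
  have hiA : Integrable fun η : EuclideanSpace ℝ (Fin 2) =>
      (‖ξ‖ ^ 2)⁻¹ * (B * (12 * (2 * Real.pi)⁻¹) * ((1 + ‖η‖) ^ 1 * Real.exp (-(1 / 8) * ‖η‖ ^ 2))) :=
    (hI₁.const_mul _).const_mul _
  have hiB : Integrable fun η : EuclideanSpace ℝ (Fin 2) =>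
      Real.exp (-(1 / 64) * ‖ξ‖ ^ 2) * (B * (2 * Real.pi)⁻¹ *
        ((ball (0 : EuclideanSpace ℝ (Fin 2)) 1).indicator (fun z => ‖z‖⁻¹) (ξ - η) +
          2 * ((1 + ‖η‖) ^ 0 * Real.exp (-(1 / 16) * ‖η‖ ^ 2)))) := (hi12.const_mul _).const_mul _
  have hbi : Integrable bound := by rw [hbdef]; exact hiA.add hiB
  have hbI : ∫ η, bound η = (‖ξ‖ ^ 2)⁻¹ * K₁ + Real.exp (-(1 / 64) * ‖ξ‖ ^ 2) * K₂ := by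
    rw [hbdef, hK₁, hK₂, hI₁def, hIind, hI16def]
    rw [integral_add hiA hiB, integral_const_mul, integral_const_mul, integral_const_mul, integral_const_mul,
      integral_add hi1 hi2, integral_const_mul,
      integral_sub_left_eq_self ((ball (0 : EuclideanSpace ℝ (Fin 2)) 1).indicator fun z => ‖z‖⁻¹) volume ξ]
  have hexp : Real.exp (-(1 / 64) * ‖ξ‖ ^ 2) ≤ 64 / ‖ξ‖ ^ 2 := by
    have h1 : (1 / 64) * ‖ξ‖ ^ 2 ≤ Real.exp ((1 / 64) * ‖ξ‖ ^ 2) := by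
      linarith [Real.add_one_le_exp ((1 / 64) * ‖ξ‖ ^ 2)]
    rw [neg_mul, Real.exp_neg]
    calc (Real.exp ((1 / 64) * ‖ξ‖ ^ 2))⁻¹ ≤ ((1 / 64) * ‖ξ‖ ^ 2)⁻¹ := inv_anti₀ (by positivity) h1
      _ = 64 / ‖ξ‖ ^ 2 := by field_simp
  calc ‖∫ η, g η • (((2 * Real.pi * ‖ξ - η‖ ^ 2)⁻¹ • (ξ - η)) - (2 * Real.pi * ‖ξ‖ ^ 2)⁻¹ • ξ)‖
      ≤ ∫ η, bound η := norm_integral_le_of_norm_le hbi (Eventually.of_forall hbound)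
    _ = (‖ξ‖ ^ 2)⁻¹ * K₁ + Real.exp (-(1 / 64) * ‖ξ‖ ^ 2) * K₂ := hbI
    _ ≤ (‖ξ‖ ^ 2)⁻¹ * K₁ + 64 / ‖ξ‖ ^ 2 * K₂ := by linarith [mul_le_mul_of_nonneg_right hexp hK₂0]
    _ = (K₁ + 64 * K₂) / ‖ξ‖ ^ 2 := by field_simp

include hgc hg0 hneutral in
/-- **Global decay**: `‖∫ g(η) DN(ξ − η) dη‖ ≤ C/(1 + ‖ξ‖)²` for a neutral Gaussian-bounded density
(far field from `norm_gradLogConv_le_far`, near field from the uniform bound). [folklore] -/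
theorem norm_gradLogConv_le :
    ∃ C : ℝ, ∀ ξ : EuclideanSpace ℝ (Fin 2),
      ‖∫ η, g η • ((2 * Real.pi * ‖ξ - η‖ ^ 2)⁻¹ • (ξ - η))‖ ≤ C / (1 + ‖ξ‖) ^ 2 := by
  obtain ⟨K, hK0, hK⟩ := norm_gradLogConv_le_far hgc hg0 hneutral
  obtain ⟨M, hM⟩ := exists_integral_norm_smul_gradLogKernel_le hg0 hgc
  refine ⟨4 * K + 4 * max M 0, fun ξ => ?_⟩
  have hVle : ‖∫ η, g η • ((2 * Real.pi * ‖ξ - η‖ ^ 2)⁻¹ • (ξ - η))‖ ≤ max M 0 :=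
    ((norm_integral_le_integral_norm _).trans (hM ξ)).trans (le_max_left _ _)
  have hM0 : 0 ≤ max M 0 := le_max_right _ _
  have hpos : (0:ℝ) < (1 + ‖ξ‖) ^ 2 := by positivity
  by_cases hξ : 1 ≤ ‖ξ‖
  · calc ‖∫ η, g η • ((2 * Real.pi * ‖ξ - η‖ ^ 2)⁻¹ • (ξ - η))‖ ≤ K / ‖ξ‖ ^ 2 := hK ξ hξ
      _ ≤ 4 * K / (1 + ‖ξ‖) ^ 2 := by
          rw [div_le_div_iff₀ (by positivity) hpos]
          have h4 : (1 + ‖ξ‖) ^ 2 ≤ 4 * ‖ξ‖ ^ 2 := by nlinarith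
          nlinarith [mul_le_mul_of_nonneg_left h4 hK0]
      _ ≤ (4 * K + 4 * max M 0) / (1 + ‖ξ‖) ^ 2 := by
          gcongr; linarith
  · rw [not_le] at hξ
    calc ‖∫ η, g η • ((2 * Real.pi * ‖ξ - η‖ ^ 2)⁻¹ • (ξ - η))‖ ≤ max M 0 := hVle
      _ ≤ 4 * max M 0 / (1 + ‖ξ‖) ^ 2 := by
          rw [le_div_iff₀ hpos]
          have h4 : (1 + ‖ξ‖) ^ 2 ≤ 4 := by nlinarith [norm_nonneg ξ]
          nlinarith [mul_le_mul_of_nonneg_left h4 hM0]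
      _ ≤ (4 * K + 4 * max M 0) / (1 + ‖ξ‖) ^ 2 := by
          gcongr; linarith

end Decay

/-! ### The registered helper -/

/-- **Decay of the gradient of the logarithmic potential of a NEUTRAL density**: for `ψ = N ∗ g` with `g ∈ C¹`,
`|g|, ‖Dg‖ ≤ B e^{−‖η‖²/8}` and `∫ g = 0`, `‖∇ψ(ξ)‖ ≤ C/(1 + ‖ξ‖)²` (registered helper toward
`logPotential_neutral_energy` / `stub_coreInverse`; so `‖∇ψ‖² ∈ L¹(ℝ²)`). [folklore] -/
theorem logPotential_gradient_decay :
    ∀ (B : ℝ) (g : EuclideanSpace ℝ (Fin 2) → ℝ), ContDiff ℝ 1 g →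
      (∀ η, |g η| ≤ B * Real.exp (-(1 / 8) * ‖η‖ ^ 2)) →
      (∀ η, ‖fderiv ℝ g η‖ ≤ B * Real.exp (-(1 / 8) * ‖η‖ ^ 2)) → (∫ η, g η = 0) →
      ∃ C : ℝ, ∀ ξ : EuclideanSpace ℝ (Fin 2),
        ‖gradient (fun ξ : EuclideanSpace ℝ (Fin 2) => ∫ η, (2 * Real.pi)⁻¹ * Real.log ‖ξ - η‖ * g η) ξ‖ ≤
          C / (1 + ‖ξ‖) ^ 2 := by
  intro B g hg hg0 hg1 hneutral
  obtain ⟨C, hC⟩ := norm_gradLogConv_le hg.continuous hg0 hneutral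
  refine ⟨C, fun ξ => ?_⟩
  rw [(logPotential_gradient_eq B g hg hg0 hg1 ξ).2]
  exact hC ξ

end Summit.AnomalousDissipation.AnomalousDissipation.Theorems.MarginalStabilityChainStretchedVortexRows

end
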